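import Summits.QuantumFields.YangMills.Theorems.BalabanUVNodesN15KingModelFreeKernelThermodynamicLimit
import Summits.QuantumFields.YangMills.Theorems.BalabanUVNodesN15KingModelMassMonotonicity
import HarnessLib

/-!
# BalabanUVNodes ∕ N15 — THE KING-MODEL RUNG (PART Ε-h): THE HARNACK STEP AND STRICT POSITIVITY OF THE FREE KERNEL —
# `K_∞(z) ≥ ρ·K_∞(z ± e_μ)` (`z ≠ 0`, `ρ = c∕(m²+2c(d+1))`), `K_∞(0) ≥ 1∕(m²+2c(d+1))`, `K_∞(z) ≥ ρ^{‖z‖₁}∕(m²+2c(d+1)) > 0` (`c > 0`), and `m² ↦ K_∞` is antitone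
# (Track A, DAG node N15 = NE2; FAN-OUT v1.1 §N15 s3 «KING-MODEL RUNG»; elementary consequences of the Green equation (Ε-a) and positivity (Ε-f); count-neutral)

HONEST FRAMING.  Count-neutral (cell `pub-ymgap`, seat `pub-ymgap-dag-n15-e` g40; `--supports stmt-QuantumFields-27366 --as helper` = K3⁸).
TEMPLATE LITERATURE: C. King, Commun. Math. Phys. **102** (1986) 649–677 [King1986], (4.4) p.670 (the symbol of `c(−Δ)+m²`), (2.13) p.653, §4 p.670 l.8–13 (the operator «with
free boundary conditions (and A = 0, of course)» on the infinite lattice); [Balaban1983RegularityDecay] (2.43)–(2.44) p.584.  Part Ε-a proved the GREEN EQUATION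
`m²K_∞(z) + cΣ_μ(2K_∞(z) − K_∞(z+e_μ) − K_∞(z−e_μ)) = δ_{z,0}` on ℤ^{d+1}; part Ε-f proved `K_∞ ≥ 0` (thermodynamic limit of part Ϻ's inverse positivity).  Rearranged, the
Green equation reads `(m² + 2c(d+1))·K_∞(z) = δ_{z,0} + c·Σ_μ(K_∞(z+e_μ) + K_∞(z−e_μ))` with every summand on the right `≥ 0` — a one-step HARNACK INEQUALITY:
§1 `rhoHarnack c m² d = c∕(m² + 2c(d+1))`; ★ `freeKer_green_rearranged`; ★★ **`freeKer_harnack_add`** ∕ **`freeKer_harnack_sub`** (`K_∞(z) ≥ ρ·K_∞(z ± e_μ)` for EVERY `z`, the `δ`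
only helps), ★★ **`freeKer_zero_ge`** (`K_∞(0) ≥ 1∕(m²+2c(d+1))` — sharper than Ε-f's `1∕(m²+4c(d+1))`); §2 ★★★ **`freeKer_ge_pow`** (`K_∞(z) ≥ ρ^{‖z‖₁}·K_∞(0)`, induction along a
lattice path; `latticeL1 z = Σ_μ|z_μ|`), ★★★ **`freeKer_pos`** (`c > 0 ⇒ K_∞(z) > 0` on all of ℤ^{d+1}; quantitative: `≥ ρ^{‖z‖₁}∕(m²+2c(d+1))`, `freeKer_ge_pow_div`); §3 ★★ **`freeKer_anti_mass`**
(`m₁² ≤ m₂² ⇒ K_∞(m₂²; z) ≤ K_∞(m₁²; z)` — part Ϻ's `lapF_inv_anti_mass` on every cube passed through Ε-f's `tendsto_lapF_inv_cube`).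

PRIOR TREE ART (used, not restated): parts Ε-a (`freeKer_green`), Ε-f (`freeKer_nonneg`, `tendsto_lapF_inv_cube`, `cubePt`), Ϻ (`…MassMonotonicity.lapF_inv_anti_mass`), `B4Green244.e`.
NOT Bałaban's covariant objects; NOT a node discharge (N15 is booked through n15-a's knit, untouched); nothing continuum-YM ∕ `ℝ⁴` ∕ OS ∕ Clay.  0 `sorry`; 2 `def` (`rhoHarnack`, `latticeL1`).

HONEST SCOPE.  Elementary; `c ≥ 0`, `m² > 0` (strict positivity off the origin needs `c > 0`: at `c = 0`, `K_∞ = δ∕m²`); the lower bound `ρ^{‖z‖₁}` is the crude nearest-neighbour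
random-walk bound, not the true decay rate.  Locators: [King1986] (4.4) p.670, (2.13) p.653; [Balaban1983RegularityDecay] (2.43)–(2.44) p.584.
-/

noncomputable section

open scoped BigOperators Topology
open Finset Filter

namespace Summit.QuantumFields.YangMills.BalabanUVNodes.N15KingModelRung.TorusSpectral

open Literature.MathematicalPhysics.QuantumFieldTheory.Balaban1983to89.B4Green244 (e)
open Summit.QuantumFields.YangMills.BalabanUVNodes.N15KingModelRung.ProperTime (lapF_inv_anti_mass)

variable {d : ℕ}

/-! ## §1 The Green equation rearranged: the one-step Harnack inequality -/

section Harnack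

variable {c m2 : ℝ}

/-- THE HARNACK RATIO `ρ = c∕(m² + 2c(d+1))` of the nearest-neighbour operator `c(−Δ)+m²`. [cite: King1986, (4.4) p.670] -/
def rhoHarnack (c m2 : ℝ) (d : ℕ) : ℝ := c / (m2 + 2 * c * (d + 1))

/-- `0 ≤ ρ` (`c ≥ 0`, `m² > 0`). [folklore] -/
theorem rhoHarnack_nonneg (hc : 0 ≤ c) (hm : 0 < m2) : 0 ≤ rhoHarnack c m2 d := by unfold rhoHarnack; positivity

/-- `0 < ρ` (`c > 0`, `m² > 0`). [folklore] -/
theorem rhoHarnack_pos (hc : 0 < c) (hm : 0 < m2) : 0 < rhoHarnack c m2 d := by unfold rhoHarnack; positivity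

/-- ★ THE GREEN EQUATION REARRANGED: `(m² + 2c(d+1))·K_∞(z) = δ_{z,0} + c·Σ_μ(K_∞(z+e_μ) + K_∞(z−e_μ))`. [cite: King1986, (2.13) p.653, (4.4) p.670; Balaban1983RegularityDecay, (2.44) p.584] -/
theorem freeKer_green_rearranged (hc : 0 ≤ c) (hm : 0 < m2) (z : Fin (d + 1) → ℤ) :
    (m2 + 2 * c * (d + 1)) * freeKer c m2 z
      = (if z = 0 then 1 else 0) + c * ∑ μ, (freeKer c m2 (z + e μ) + freeKer c m2 (z - e μ)) := by
  have h := freeKer_green (d := d) hc hm z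
  rw [Finset.sum_sub_distrib, Finset.sum_sub_distrib, Finset.sum_const, Finset.card_univ, Fintype.card_fin] at h
  simp only [nsmul_eq_mul] at h
  push_cast at h
  rw [← h, Finset.sum_add_distrib]
  ring

/-- ★★ **THE HARNACK STEP, forward neighbour**: `ρ·K_∞(z + e_μ) ≤ K_∞(z)` for EVERY `z ∈ ℤ^{d+1}` and every direction (all terms of the rearranged Green equation are `≥ 0`).
[cite: King1986, (4.4) p.670; Balaban1983RegularityDecay, (2.44) p.584] -/
theorem freeKer_harnack_add (hc : 0 ≤ c) (hm : 0 < m2) (z : Fin (d + 1) → ℤ) (μ : Fin (d + 1)) :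
    rhoHarnack c m2 d * freeKer c m2 (z + e μ) ≤ freeKer c m2 z := by
  have hD : 0 < m2 + 2 * c * (d + 1) := by positivity
  have h := freeKer_green_rearranged (d := d) hc hm z
  have hδ : (0 : ℝ) ≤ (if z = 0 then 1 else 0) := by split_ifs <;> norm_num
  have hsum : freeKer c m2 (z + e μ) ≤ ∑ ν, (freeKer c m2 (z + e ν) + freeKer c m2 (z - e ν)) := by
    have h1 : freeKer c m2 (z + e μ) ≤ freeKer c m2 (z + e μ) + freeKer c m2 (z - e μ) :=
      le_add_of_nonneg_right (freeKer_nonneg hc hm _)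
    exact h1.trans (Finset.single_le_sum (f := fun ν => freeKer c m2 (z + e ν) + freeKer c m2 (z - e ν))
      (fun ν _ => add_nonneg (freeKer_nonneg hc hm _) (freeKer_nonneg hc hm _)) (Finset.mem_univ μ))
  unfold rhoHarnack
  rw [div_mul_eq_mul_div, div_le_iff₀ hD]
  nlinarith [mul_le_mul_of_nonneg_left hsum hc]

/-- ★★ **THE HARNACK STEP, backward neighbour**: `ρ·K_∞(z − e_μ) ≤ K_∞(z)`. [cite: King1986, (4.4) p.670; Balaban1983RegularityDecay, (2.44) p.584] -/
theorem freeKer_harnack_sub (hc : 0 ≤ c) (hm : 0 < m2) (z : Fin (d + 1) → ℤ) (μ : Fin (d + 1)) :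
    rhoHarnack c m2 d * freeKer c m2 (z - e μ) ≤ freeKer c m2 z := by
  have h := freeKer_harnack_add (d := d) hc hm (-z) μ
  rw [show -z + e μ = -(z - e μ) by abel, freeKer_neg, freeKer_neg] at h
  exact h

/-- ★★ **THE ORIGIN**: `K_∞(0) ≥ 1∕(m² + 2c(d+1))` (the `δ` term; sharper than part Ε-f's `1∕(m² + 4c(d+1))`). [cite: King1986, (4.4) p.670] -/
theorem freeKer_zero_ge (hc : 0 ≤ c) (hm : 0 < m2) : (m2 + 2 * c * (d + 1))⁻¹ ≤ freeKer c m2 (0 : Fin (d + 1) → ℤ) := by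
  have hD : 0 < m2 + 2 * c * (d + 1) := by positivity
  have h := freeKer_green_rearranged (d := d) hc hm 0
  rw [if_pos rfl] at h
  have hsum : 0 ≤ c * ∑ μ : Fin (d + 1), (freeKer c m2 (0 + e μ) + freeKer c m2 (0 - e μ)) :=
    mul_nonneg hc (Finset.sum_nonneg fun μ _ => add_nonneg (freeKer_nonneg hc hm _) (freeKer_nonneg hc hm _))
  rw [inv_le_iff_one_le_mul₀ hD]
  linarith

end Harnack

/-! ## §2 Iterating along a lattice path: quantitative strict positivity -/

section Positivity

variable {c m2 : ℝ}

/-- the `ℓ¹`-length `‖z‖₁ = Σ_μ |z_μ|` of a lattice vector, as a natural number. [folklore] -/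
def latticeL1 (z : Fin (d + 1) → ℤ) : ℕ := ∑ μ, (z μ).natAbs

/-- a non-zero vector has a coordinate that can be moved one step towards the origin, shortening `‖·‖₁` by one. [folklore] -/
theorem exists_step_of_ne_zero {z : Fin (d + 1) → ℤ} (hz : z ≠ 0) :
    ∃ μ, (latticeL1 (z - e μ) + 1 = latticeL1 z) ∨ (latticeL1 (z + e μ) + 1 = latticeL1 z) := by
  obtain ⟨μ, hμ⟩ : ∃ μ, z μ ≠ 0 := by
    by_contra h
    push Not at h
    exact hz (funext h)
  refine ⟨μ, ?_⟩
  have hsplit : ∀ w : Fin (d + 1) → ℤ, latticeL1 w = (w μ).natAbs + ∑ ν ∈ Finset.univ.erase μ, (w ν).natAbs := fun w => by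
    unfold latticeL1; rw [← Finset.add_sum_erase _ _ (Finset.mem_univ μ)]
  have hoff : ∀ (s : ℤ) (ν : Fin (d + 1)), ν ∈ Finset.univ.erase μ → ((z + s • e μ) ν).natAbs = (z ν).natAbs := by
    intro s ν hν
    have hne : ν ≠ μ := Finset.ne_of_mem_erase hν
    simp [e, Pi.single_eq_of_ne hne]
  rcases lt_or_gt_of_ne hμ with hneg | hpos
  · right
    rw [hsplit (z + e μ), hsplit z, Finset.sum_congr rfl (fun ν hν => by simpa using hoff 1 ν hν)]
    have : ((z + e μ) μ).natAbs + 1 = (z μ).natAbs := by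
      simp only [Pi.add_apply, e, Pi.single_eq_same]
      omega
    omega
  · left
    rw [hsplit (z - e μ), hsplit z, Finset.sum_congr rfl (fun ν hν => by simpa [sub_eq_add_neg] using hoff (-1) ν hν)]
    have : ((z - e μ) μ).natAbs + 1 = (z μ).natAbs := by
      simp only [Pi.sub_apply, e, Pi.single_eq_same]
      omega
    omega

/-- ★★★ **QUANTITATIVE POSITIVITY**: `K_∞(z) ≥ ρ^{‖z‖₁}·K_∞(0)` for every `z ∈ ℤ^{d+1}` (the Harnack step iterated along a lattice path from `0` to `z`).
[cite: King1986, (4.4) p.670; Balaban1983RegularityDecay, (2.44) p.584] -/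
theorem freeKer_ge_pow (hc : 0 ≤ c) (hm : 0 < m2) (z : Fin (d + 1) → ℤ) :
    rhoHarnack c m2 d ^ latticeL1 z * freeKer c m2 (0 : Fin (d + 1) → ℤ) ≤ freeKer c m2 z := by
  have hρ := rhoHarnack_nonneg (d := d) hc hm
  suffices h : ∀ n : ℕ, ∀ z : Fin (d + 1) → ℤ, latticeL1 z = n → rhoHarnack c m2 d ^ n * freeKer c m2 0 ≤ freeKer c m2 z from h _ z rfl
  intro n
  induction n with
  | zero =>
    intro z hz
    have h0 : z = 0 := by
      funext μ
      have : (z μ).natAbs = 0 := by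
        have := Finset.sum_eq_zero_iff.mp hz μ (Finset.mem_univ μ); exact this
      exact Int.natAbs_eq_zero.mp this
    rw [h0, pow_zero, one_mul]
  | succ n ih =>
    intro z hz
    have hz0 : z ≠ 0 := by
      rintro rfl
      simp [latticeL1] at hz
    obtain ⟨μ, hμ | hμ⟩ := exists_step_of_ne_zero hz0
    · have hprev : latticeL1 (z - e μ) = n := by omega
      have h1 := ih (z - e μ) hprev
      have h2 := freeKer_harnack_sub (d := d) hc hm z μ
      calc rhoHarnack c m2 d ^ (n + 1) * freeKer c m2 0 = rhoHarnack c m2 d * (rhoHarnack c m2 d ^ n * freeKer c m2 0) := by ring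
        _ ≤ rhoHarnack c m2 d * freeKer c m2 (z - e μ) := mul_le_mul_of_nonneg_left h1 hρ
        _ ≤ freeKer c m2 z := h2
    · have hprev : latticeL1 (z + e μ) = n := by omega
      have h1 := ih (z + e μ) hprev
      have h2 := freeKer_harnack_add (d := d) hc hm z μ
      calc rhoHarnack c m2 d ^ (n + 1) * freeKer c m2 0 = rhoHarnack c m2 d * (rhoHarnack c m2 d ^ n * freeKer c m2 0) := by ring
        _ ≤ rhoHarnack c m2 d * freeKer c m2 (z + e μ) := mul_le_mul_of_nonneg_left h1 hρ
        _ ≤ freeKer c m2 z := h2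

/-- ★★ the explicit lower bound `K_∞(z) ≥ ρ^{‖z‖₁}∕(m² + 2c(d+1))`. [cite: King1986, (4.4) p.670] -/
theorem freeKer_ge_pow_div (hc : 0 ≤ c) (hm : 0 < m2) (z : Fin (d + 1) → ℤ) :
    rhoHarnack c m2 d ^ latticeL1 z * (m2 + 2 * c * (d + 1))⁻¹ ≤ freeKer c m2 z :=
  le_trans (mul_le_mul_of_nonneg_left (freeKer_zero_ge hc hm) (pow_nonneg (rhoHarnack_nonneg hc hm) _)) (freeKer_ge_pow hc hm z)

/-- ★★★ **STRICT POSITIVITY OF THE FREE KERNEL**: for `c > 0`, `m² > 0`, `K_∞(z) > 0` for EVERY `z ∈ ℤ^{d+1}`. [cite: King1986, (4.4) p.670; Balaban1983RegularityDecay, (2.43)–(2.44) p.584] -/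
theorem freeKer_pos (hc : 0 < c) (hm : 0 < m2) (z : Fin (d + 1) → ℤ) : 0 < freeKer c m2 z :=
  lt_of_lt_of_le (mul_pos (pow_pos (rhoHarnack_pos hc hm) _) (inv_pos.mpr (by positivity))) (freeKer_ge_pow_div hc.le hm z)

/-- At the origin, unconditionally in `c ≥ 0`: `K_∞(0) > 0`. [cite: King1986, (4.4) p.670] -/
theorem freeKer_zero_pos (hc : 0 ≤ c) (hm : 0 < m2) : 0 < freeKer c m2 (0 : Fin (d + 1) → ℤ) :=
  lt_of_lt_of_le (inv_pos.mpr (by positivity)) (freeKer_zero_ge hc hm)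

end Positivity

/-! ## §3 Monotonicity in the mass -/

section Mass

/-- ★★ **`m² ↦ K_∞(m²; z)` IS ANTITONE**: `0 < m₁² ≤ m₂² ⇒ K_∞(m₂²; z) ≤ K_∞(m₁²; z)` (part Ϻ's `lapF_inv_anti_mass` on every cube, through part Ε-f's thermodynamic limit).
[cite: King1986, (4.4) p.670] -/
theorem freeKer_anti_mass {c m1 m2 : ℝ} (hc : 0 ≤ c) (h1 : 0 < m1) (h12 : m1 ≤ m2) (z : Fin (d + 1) → ℤ) : freeKer c m2 z ≤ freeKer c m1 z :=
  le_of_tendsto_of_tendsto' (tendsto_lapF_inv_cube (d := d) hc (lt_of_lt_of_le h1 h12) z) (tendsto_lapF_inv_cube (d := d) hc h1 z)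
    fun N => lapF_inv_anti_mass (fun _ : Fin (d + 1) => N + 1) hc h1 h12 _ _

end Mass

end Summit.QuantumFields.YangMills.BalabanUVNodes.N15KingModelRung.TorusSpectral

end
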